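import Summits.BirchSwinnertonDyer.Rank1Residual.GaloisImage.PrimeChoiceSakamotoSubgroup
import HarnessLib

/-!
# The thinned prime choice in BINDER form: `hch` (R1-56) / `hC55` (R1-16) for a datum whose primes
# contain `𝒫 ∩ {Frob ∈ τ·(ker ρ ⊓ 𝒰)}` (cell `b2b-bsdres`, n1011-p11 GEN 12; rider of row T-PC-THIN)
HONEST FRAMING (verbatim for the cell): research route on the CONSTRUCTION-SHAPED class X4 / §I N11
(END-b); TOOL theorems only (`PrimeChoiceSakamotoSubgroup`'s ★★ theorem under `Set.Infinite.mono`);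
no claim beyond stated classes; nothing booked; no mark moved; no definition, no named fact. -/

noncomputable section

open Field NumberField IsDedekindDomain
open Literature.NumberTheory.GaloisRepresentations Literature.NumberTheory.GaloisCohomology
open scoped NumberField

namespace Summit.BirchSwinnertonDyer.Rank1Residual.GaloisImage.PrimeChoice

variable {K : Type} [Field K] [NumberField K] {M : Type} [AddCommGroup M] [TopologicalSpace M]
  [DiscreteTopology M] [Finite M] (ρ : DiscreteGaloisModule K M) {p : ℕ} [Fact p.Prime] {N : ℕ}
  (hN : N ≠ 0) {S : Set (HeightOneSpectrum (𝓞 K))} (hS : S.Finite)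
  {𝒰 : Subgroup (absoluteGaloisGroup K)} [𝒰.Normal] (h𝒰 : IsOpen (𝒰 : Set (absoluteGaloisGroup K)))
  (h𝒰N : 𝒰 ≤ rootsOfUnityFixer K N) {τ : absoluteGaloisGroup K}
  (hτ : Nonempty (cokerSubOne ρ τ ≃+ ZMod p))
  (hirr : ∀ A : AddSubgroup M, (∀ (s : absoluteGaloisGroup K), ∀ m ∈ A, ρ s m ∈ A) → A = ⊥ ∨ A = ⊤)
  (hH3 : ∀ f : contOneCocycles ρ.toTopRep,
    (∀ u : absoluteGaloisGroup K, ρ u = 1 → u ∈ 𝒰 → f.1 u = 0) → oneCocycleClass ρ.toTopRep f = 0)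
  {D : KolyvaginDatum ρ}
  (hP : frobeniusClassPrimes ρ S τ N ∩ {q | ∃ 𝔓 ∈ q.primesAbove, ∃ σ : absoluteGaloisGroup K,
      IsArithFrobAt (𝓞 K) σ 𝔓 ∧ ρ (σ * τ⁻¹) = 1 ∧ σ * τ⁻¹ ∈ 𝒰} ⊆ D.primes)
include hN hS h𝒰 h𝒰N hτ hirr hH3 hP
/-- **`hch` for a thinned datum** (`𝒫(D) ⊇ 𝒫 ∩ {Frob ∈ τ·(ker ρ ⊓ 𝒰)}`, `2 ≤ p`): LITERALLY the
binder `hch` of `CoreRankOne.…` (R1-56). [cite: Sakamoto2024, Lemma 5.2 and Cor. 5.5 (pp. 928–930)] -/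
theorem hch_of_thinned_primes_subset (hp : 2 ≤ p) :
    ∀ c₁ c₂ : galoisCohomology ρ 1, c₁ ≠ 0 → c₂ ≠ 0 →
      {q ∈ D.primes | galoisCohomology.localization ρ (Sum.inr q) 1 c₁ ≠ 0 ∧
        galoisCohomology.localization ρ (Sum.inr q) 1 c₂ ≠ 0}.Infinite := by
  intro c₁ c₂ h₁ h₂
  have hc : ∀ i : Fin 2, ![c₁, c₂] i ≠ 0 := fun i => by fin_cases i <;> assumption
  refine (infinite_setOf_mem_frobeniusClassPrimes_forall_localization_ne_zero_of_subgroup ρ hN S hS 𝒰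
    h𝒰 h𝒰N hτ hirr hH3 hp ![c₁, c₂] hc).mono ?_
  rintro q ⟨hq, h, hfrob⟩
  exact ⟨hP ⟨hq, hfrob⟩, h 0, h 1⟩

/-- **`hC55` for a thinned datum** (`3 ≤ p`): LITERALLY the binder `hC55` of `CoreRankZero.…`
(R1-16) — Sakamoto's Cor. 5.5 inside the thinner set. [cite: Sakamoto2024, Cor. 5.5 (p. 929)] -/
theorem hC55_of_thinned_primes_subset (hp : 3 ≤ p) :
    ∀ c₁ c₂ c₃ : galoisCohomology ρ 1, c₁ ≠ 0 → c₂ ≠ 0 → c₃ ≠ 0 →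
      {q ∈ D.primes | galoisCohomology.localization ρ (Sum.inr q) 1 c₁ ≠ 0 ∧
        galoisCohomology.localization ρ (Sum.inr q) 1 c₂ ≠ 0 ∧
        galoisCohomology.localization ρ (Sum.inr q) 1 c₃ ≠ 0}.Infinite := by
  intro c₁ c₂ c₃ h₁ h₂ h₃
  have hc : ∀ i : Fin 3, ![c₁, c₂, c₃] i ≠ 0 := fun i => by fin_cases i <;> assumption
  refine (infinite_setOf_mem_frobeniusClassPrimes_forall_localization_ne_zero_of_subgroup ρ hN S hS 𝒰
    h𝒰 h𝒰N hτ hirr hH3 hp ![c₁, c₂, c₃] hc).mono ?_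
  rintro q ⟨hq, h, hfrob⟩
  exact ⟨hP ⟨hq, hfrob⟩, h 0, h 1, h 2⟩
end Summit.BirchSwinnertonDyer.Rank1Residual.GaloisImage.PrimeChoice

end
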